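import Literature.Topology.FourManifolds.BandFromCore
import Literature.Topology.FourManifolds.BandCoreRebuild
import HarnessLib

/-!
# Existence of band sums: discharge of `Knot.exists_isBandSum`

Topic `Literature/Topology/FourManifolds` (trunk T-4MAN). Fact seat
`provefact-Literature.Topology.FourManifolds.Knot.exists_isBandSum`.  This file discharges the
named fact `Literature.Topology.FourManifolds.Knot.exists_isBandSum` of `BandSum.lean`
(R. E. Gompf, A. I. Stipsicz, *4-Manifolds and Kirby Calculus* (1999), §5.1: the band sum
`K₁ #_b K₂` of two components of a link along a band `b` connecting them and disjoint from the
rest of the link exists):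

> if `K₁`, `K₂` are disjoint knots, `avoid` is a closed set missing both, and some path from
> `K₁` to `K₂` misses `avoid`, then there is a knot `K` which is a band sum of `K₁`, `K₂` along a
> band avoiding `avoid` (`Knot.IsBandSum K₁ K₂ K avoid`, i.e. `Nonempty (BandData K₁ K₂ K avoid)`).

**Proof** (assembled from the tree).

1. *The band* (`Knot.exists_preBandData`, `BandFromCore.lean`): tubular neighbourhoods of the
   two knots shrunk off `avoid` and off each other; the given path reduced to a path in
   `O = avoidᶜ ∖ (K₁ ∪ K₂)` between the two punctured tubes; an embedded core arc from
   `K₁ (1, 0)` to `K₂ (1, 0)` leaving and arriving along radial segments of the tubes, obtained as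
   half of an embedded circle by smoothing and general position in dimension `3`
   (`exists_coreLoop`, `BandCoreLoop.lean`; Milnor (1965), proof of Lemma 8.3 with Whitney's
   Lemma 6.12, `LoopGeneralPositionTwoArcs.lean`); the band as the normalisation of a blend of
   the two flat strips of the tubes with a ruled strip along a normal field of the core solved by
   Cramer's rule (`BandFrames.lean`), an injective immersion on a thin collar square meeting `K₁`
   exactly in its left edge line (upwards) and `K₂` exactly in its right edge line (downwards):
   pre-band data `PreBandData K₁ K₂ avoid` (`PreBandData.lean`).
2. *The knot* (`PreBandData.exists_isBandSum`, `BandCoreRebuild.lean`, via `BandCore.lean`): the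
   rebuilding construction of `BandRebuildArches.lean`, `BandRebuildCurve.lean`,
   `SchubertNormalForm.lean` for `K`-free band data: lift the two edges to the parameter circles
   of the summands, join them by two standard planar arches, glue the four pieces into a `C^∞`
   regular simple closed curve on `S³` (`KnotOfClosedCurve.lean`), and verify the clauses of
   `BandData` for the rebuilt knot along the same band.

No named facts are used: the discharge is unconditional.

## References

* R. E. Gompf, A. I. Stipsicz, *4-Manifolds and Kirby Calculus*, GSM 20, AMS (1999), §5.1
  (band sums and handle slides, Fig. 5.7). [GompfStipsicz1999]
* P. R. Cromwell, *Knots and Links*, Cambridge University Press (2004), §4.6 (the product of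
  knots along a rectangle). [Cromwell2004]
* J. Milnor, *Lectures on the h-cobordism theorem* (1965), proof of Lemma 8.3 and Lemma 6.12
  (general position of curves in dimension `≥ 3`). [MilnorHCobordism1965]
* M. W. Hirsch, *Differential Topology*, GTM 33 (1976), Ch. 4 §5 (tubular neighbourhoods),
  Ch. 2 §1 (local form of immersions). [HirschDT1976]
-/

open Function Set

noncomputable section

namespace Literature.Topology.FourManifolds

/-- **Existence of band sums** — discharge of the named fact
`Literature.Topology.FourManifolds.Knot.exists_isBandSum` (`BandSum.lean`): if `K₁`, `K₂` are
disjoint knots, `avoid` is a closed set missing both, and some path from `K₁` to `K₂` misses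
`avoid`, then some knot `K` is a band sum of `K₁`, `K₂` along a band avoiding `avoid`.  The band
is `Knot.exists_preBandData` (`BandFromCore.lean`), the knot is the rebuilt knot along it
(`PreBandData.exists_isBandSum`, `BandCoreRebuild.lean`).  Gompf–Stipsicz (1999), §5.1.
[cite: GompfStipsicz1999, §5.1] -/
theorem Knot.exists_isBandSum_holds : Knot.exists_isBandSum := by
  intro K₁ K₂ avoid hdisj havoid h₁ h₂ hpath
  obtain ⟨b⟩ := Knot.exists_preBandData K₁ K₂ avoid hdisj havoid h₁ h₂ hpath
  exact b.exists_isBandSum hdisj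

end Literature.Topology.FourManifolds
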